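import Summits.ResolutionOfSingularities.ResolutionOfSingularities.Theorems.WeightedInvariantHypersurfaceLocalGameEFT3
import Mathlib.RingTheory.LocalRing.MaximalIdeal.Basic
import Mathlib.RingTheory.Ideal.Maps
import HarnessLib

/-!
# E2 tier, (o59-loc) FIRST PIECE: transport of `ι` and of the order-`≥ 2` condition along a ring isomorphism, up to a unit

[OURS · L1 W4.3 · door `HypersurfaceCentreConstruction` (stmt-ResolutionOfSingularities-19897) · registrar res-L1-w43-plan-1 E2-CENSUS v0 §6
«(o59-loc) `E2InvSuccLocBody` — OVER branch … transport `ι(𝒪_{Y′,η′}, f′_{η′}) = ι(B_𝔫, g/1)` by (c6) `IotaIsoInvariant` along `e` and (c-u)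
`IotaUnitInvariant` for the unit ambiguity»; OFFER (o59-loc) FIRST PIECE to res-D-pv-056 AS res-L1-w43-stub-5, STATUS 2026-08-27T16:01:19Z.
Kernel algebra, no geometry; def-free; `--supports stmt-ResolutionOfSingularities-19897 --as helper`.  Not a statement of [Hironaka2017].]

The registrar's wording names `e : Localization.AtPrime 𝔫 ≃+* T`; the lemmas below are stated for an ARBITRARY ring isomorphism `e : A ≃+* T`
of commutative rings (resp. of local rings for the `𝔪²` clause) and an `Associated (e x) y`, so they instantiate at `A = Localization.AtPrime 𝔫`
(both branches of `E2InvSuccLocBody` use the same two facts):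
* `iota_eq_of_ringEquiv_of_associated` — `IotaIsoInvariant ι → IotaUnitInvariant ι → Associated (e x) y → ι T y = ι A x`;
* `mem_ideal_iff_of_associated` — associated elements lie in the same ideals;
* `map_maximalIdeal_ringEquiv` — a ring isomorphism of local rings maps the maximal ideal ONTO the maximal ideal (and its square onto the square);
* `mem_maximalIdeal_sq_iff_of_ringEquiv_of_associated` — `y ∈ 𝔪_T² ↔ x ∈ 𝔪_A²` (and the same for every power `𝔪ⁿ`).
-/

set_option linter.dupNamespace false -- mandated namespace of this single-conjunct summit

namespace Summit.ResolutionOfSingularities.ResolutionOfSingularities.Cruxes.HypersurfaceCentreConstruction.LocalEngine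

namespace IotaTransport

/-- **Transport of `ι` along a ring isomorphism up to a unit.** If `ι` is invariant under ring isomorphisms ((c6) `IotaIsoInvariant`) and under
multiplication by units ((c-u) `IotaUnitInvariant`), then for a ring isomorphism `e : A ≃+* T` and `Associated (e x) y` one has `ι T y = ι A x`.
[folklore] -/
theorem iota_eq_of_ringEquiv_of_associated (ι : (R : Type) → [CommRing R] → R → Ordinal.{0})
    (hiso : IotaIsoInvariant ι) (hunit : IotaUnitInvariant ι)
    {A T : Type} [CommRing A] [CommRing T] (e : A ≃+* T) {x : A} {y : T} (h : Associated (e x) y) :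
    ι T y = ι A x := by
  obtain ⟨u, hu⟩ := h
  rw [← hu, mul_comm, hunit T (↑u) (e x) u.isUnit]
  exact hiso A T e x

/-- Associated elements of a commutative ring lie in the same ideals. [folklore] -/
theorem mem_ideal_iff_of_associated {T : Type} [CommRing T] {a b : T} (h : Associated a b) (I : Ideal T) : a ∈ I ↔ b ∈ I := by
  obtain ⟨u, hu⟩ := h
  constructor
  · intro ha; rw [← hu]; exact I.mul_mem_right _ ha
  · intro hb
    have : b * ↑u⁻¹ = a := by rw [← hu, mul_assoc, Units.mul_inv, mul_one]
    rw [← this]; exact I.mul_mem_right _ hb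

/-- A ring isomorphism of local rings maps the maximal ideal onto the maximal ideal. [folklore] -/
theorem map_maximalIdeal_ringEquiv {A T : Type} [CommRing A] [IsLocalRing A] [CommRing T] [IsLocalRing T] (e : A ≃+* T) :
    (IsLocalRing.maximalIdeal A).map e = IsLocalRing.maximalIdeal T :=
  IsLocalRing.eq_maximalIdeal
    ((Ideal.isMaximal_map_iff_of_bijective e e.bijective).mpr (IsLocalRing.maximalIdeal.isMaximal A))

/-- … hence every power `𝔪_Aⁿ` onto `𝔪_Tⁿ`. [folklore] -/
theorem map_maximalIdeal_pow_ringEquiv {A T : Type} [CommRing A] [IsLocalRing A] [CommRing T] [IsLocalRing T] (e : A ≃+* T) (n : ℕ) :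
    ((IsLocalRing.maximalIdeal A) ^ n).map e = (IsLocalRing.maximalIdeal T) ^ n := by
  rw [Ideal.map_pow, map_maximalIdeal_ringEquiv]

/-- **Transport of `x ∈ 𝔪ⁿ` along a ring isomorphism up to a unit**: for local rings `A`, `T`, a ring isomorphism `e : A ≃+* T` and
`Associated (e x) y`, `y ∈ 𝔪_Tⁿ ↔ x ∈ 𝔪_Aⁿ`. [folklore] -/
theorem mem_maximalIdeal_pow_iff_of_ringEquiv_of_associated {A T : Type} [CommRing A] [IsLocalRing A] [CommRing T] [IsLocalRing T]
    (e : A ≃+* T) {x : A} {y : T} (h : Associated (e x) y) (n : ℕ) :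
    y ∈ (IsLocalRing.maximalIdeal T) ^ n ↔ x ∈ (IsLocalRing.maximalIdeal A) ^ n := by
  rw [← mem_ideal_iff_of_associated h, ← map_maximalIdeal_pow_ringEquiv e n, Ideal.apply_mem_of_equiv_iff]

/-- **The `𝔪²` clause of E2-CENSUS §6 (o59-loc)**: `y ∈ 𝔪_T² ↔ x ∈ 𝔪_A²` for `e : A ≃+* T` an isomorphism of local rings and `Associated (e x) y`
(in the registrar's use `A = Localization.AtPrime 𝔫`, `x = g/1`, `T = 𝒪_{Y′,η′}`, `y = f′_{η′}`). [folklore] -/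
theorem mem_maximalIdeal_sq_iff_of_ringEquiv_of_associated {A T : Type} [CommRing A] [IsLocalRing A] [CommRing T] [IsLocalRing T]
    (e : A ≃+* T) {x : A} {y : T} (h : Associated (e x) y) :
    y ∈ (IsLocalRing.maximalIdeal T) ^ 2 ↔ x ∈ (IsLocalRing.maximalIdeal A) ^ 2 :=
  mem_maximalIdeal_pow_iff_of_ringEquiv_of_associated e h 2

/-- **Both transports at once, at a localisation** (the shape the (o59-loc) holder consumes): for `e : Localization.AtPrime 𝔫 ≃+* T`,
`Associated (e x) y`, (c6) and (c-u): `ι T y = ι (Localization.AtPrime 𝔫) x` and `y ∈ 𝔪_T² ↔ x ∈ 𝔪²`. [folklore] -/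
theorem over_branch_transport (ι : (R : Type) → [CommRing R] → R → Ordinal.{0})
    (hiso : IotaIsoInvariant ι) (hunit : IotaUnitInvariant ι)
    {B : Type} [CommRing B] (𝔫 : Ideal B) [𝔫.IsPrime] {T : Type} [CommRing T] [IsLocalRing T]
    (e : Localization.AtPrime 𝔫 ≃+* T) {x : Localization.AtPrime 𝔫} {y : T} (h : Associated (e x) y) :
    ι T y = ι (Localization.AtPrime 𝔫) x ∧
      (y ∈ (IsLocalRing.maximalIdeal T) ^ 2 ↔ x ∈ (IsLocalRing.maximalIdeal (Localization.AtPrime 𝔫)) ^ 2) :=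
  ⟨iota_eq_of_ringEquiv_of_associated ι hiso hunit e h, mem_maximalIdeal_sq_iff_of_ringEquiv_of_associated e h⟩

/-! ## rev 2 (APPEND-ONLY): the remaining declarations of the registrar's SPEC (Δ3) `L/res-L1-w43-plan-1/IotaTransport_sketch.lean`
fa213c76bda5ea5b (ORDER (o58c) 2026-08-27T16:07:29Z), added VERBATIM where the name is free and under a primed name where rev 1 already uses the
name with a different shape (`mem_ideal_iff_of_associated` — rev 1 takes the ideal EXPLICITLY; `map_maximalIdeal_ringEquiv` — rev 1 states
`Ideal.map e`, the SPEC `Ideal.map (e : R →+* T)`).  Name table for the skeleton: SPEC `iota_eq_of_associated` = `iota_eq_of_associated` ·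
SPEC `iota_eq_of_ringEquiv_of_associated` = rev 1 `iota_eq_of_ringEquiv_of_associated` (same explicit arguments, same order) · SPEC
`mem_ideal_iff_of_associated` = `mem_ideal_iff_of_associated'` · SPEC `apply_mem_maximalIdeal_iff` = `apply_mem_maximalIdeal_iff` · SPEC
`map_maximalIdeal_ringEquiv` = `map_maximalIdeal_ringEquiv'` · SPEC `mem_maximalIdeal_sq_iff_of_ringEquiv_of_associated` = rev 1 (same shape). -/

/-- `ι` is constant on associate classes when it is unit invariant (SPEC (Δ3) verbatim). [folklore] -/
theorem iota_eq_of_associated (ι : (R : Type) → [CommRing R] → R → Ordinal.{0}) (hunit : IotaUnitInvariant ι)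
    {T : Type} [CommRing T] {x y : T} (h : Associated x y) : ι T y = ι T x := by
  obtain ⟨u, rfl⟩ := h
  rw [mul_comm]
  exact hunit T (u : T) x u.isUnit

/-- Associates lie in the same ideals — SPEC (Δ3) shape (ideal implicit). [folklore] -/
theorem mem_ideal_iff_of_associated' {T : Type} [CommRing T] {I : Ideal T} {x y : T} (h : Associated x y) : x ∈ I ↔ y ∈ I :=
  mem_ideal_iff_of_associated h I

/-- A ring isomorphism of local rings respects membership in the maximal ideal (SPEC (Δ3) verbatim). [folklore] -/
theorem apply_mem_maximalIdeal_iff {R T : Type} [CommRing R] [CommRing T] [IsLocalRing R] [IsLocalRing T] (e : R ≃+* T) (a : R) :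
    e a ∈ IsLocalRing.maximalIdeal T ↔ a ∈ IsLocalRing.maximalIdeal R := by
  simp only [IsLocalRing.mem_maximalIdeal, mem_nonunits_iff]
  exact not_congr (MulEquiv.isUnit_map e)

/-- A ring isomorphism of local rings maps the maximal ideal onto the maximal ideal — SPEC (Δ3) shape, stated for the coerced ring
homomorphism `(e : R →+* T)`. [folklore] -/
theorem map_maximalIdeal_ringEquiv' {R T : Type} [CommRing R] [CommRing T] [IsLocalRing R] [IsLocalRing T] (e : R ≃+* T) :
    (IsLocalRing.maximalIdeal R).map (e : R →+* T) = IsLocalRing.maximalIdeal T := by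
  ext y
  constructor
  · intro hy
    obtain ⟨x, hx, rfl⟩ := (Ideal.mem_map_of_equiv e y).mp hy
    exact (apply_mem_maximalIdeal_iff e x).mpr hx
  · intro hy
    exact (Ideal.mem_map_of_equiv e y).mpr ⟨e.symm y, (apply_mem_maximalIdeal_iff e _).mp (by simpa using hy), by simp⟩

end IotaTransport

end Summit.ResolutionOfSingularities.ResolutionOfSingularities.Cruxes.HypersurfaceCentreConstruction.LocalEngine
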